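import Summits.NavierStokesRegularity.NavierStokesRegularity.Theorems.AdaptedFrequencyFrequencyRigidityFiniteRSSProfileDecay
import Summits.NavierStokesRegularity.NavierStokesRegularity.Theorems.AdaptedFrequencyFrequencyRigidityRSSViscosityNormalisation
import Summits.NavierStokesRegularity.NavierStokesRegularity.Theorems.AdaptedFrequencyFrequencyRigidityViscosityNormalisation
import HarnessLib

/-!
# Crux `FrequencyRigidity` (stmt-NavierStokesRegularity-2955), line `scaled-energy-split`:
# RSS witnesses of the finite piece have decaying profiles — any viscosity

Helper file (`--supports stmt-NavierStokesRegularity-2955`; theorems only, sorry-free).  Stub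
`stub_rssWitnessDecays` (sub-goal (H) of Stub 2): the general-viscosity form of sub-goal (A)
(`stub_finiteRSSProfileDecay`, unit viscosity).  A classical Navier–Stokes flow with viscosity
`ν > 0` on `(−∞, 0)` of rotated self-similar form `v = pvAnsatz α U` (Pineau–Vicol 2026 (1.7))
whose Albritton–Barker quantity `𝐈(ℝ³ × ℝ₋)` is finite has a profile with Pineau–Vicol decay
`‖U(y)‖ ≤ C₀/(1 + ‖y‖)`.

Proof.  The viscosity normalisation `u(t,x) = ν⁻¹ v(ν⁻¹ t, x)` of lead c6 is a unit-viscosity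
classical flow with `𝐈 < ∞` (`classical_viscosity`, `typeIBound_viscosity_lt_top`) and is RSS with
the explicit profile `Ũ(y) = (√ν)⁻¹ R(α log ν) U(√ν R(−α log ν) y)`
(`stub_rssViscosityNormalisation`); sub-goal (A) gives the decay of `Ũ`, which is the decay of `U`
with the constant multiplied by `√ν + ν`.

## References

* T.-P. Tsai, Arch. Rational Mech. Anal. 143 (1998) 29–51, Corollary 4.3. [Tsai1998]
* B. Pineau, V. Vicol, arXiv:2607.09619 (2026), (1.7), Remark 1.2. [PineauVicol2026]
-/

noncomputable section

set_option linter.dupNamespace false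

namespace Summit.NavierStokesRegularity.NavierStokesRegularity.Theorems.FrequencyRigidity.ScaledEnergySplit

open Literature.Analysis.FluidPDE MeasureTheory Set Function Metric Filter Topology

/-- **Undoing the normalisation of the profile.**  If
`Ũ(y) = (√ν)⁻¹ R(c) U(√ν R(−c) y)` decays with constant `C`, then `U` decays with constant
`C(√ν + ν)`: evaluate at `y = (√ν)⁻¹ R(c) z` and use `ν/(√ν + r) ≤ (√ν + ν)/(1 + r)`. [folklore] -/
theorem rssWitness_decay_of_normalised {ν c C : ℝ} (hν : 0 < ν)
    {U : EuclideanSpace ℝ (Fin 3) → EuclideanSpace ℝ (Fin 3)}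
    (h : ∀ y, ‖(Real.sqrt ν)⁻¹ • rotZ c (U (Real.sqrt ν • rotZ (-c) y))‖ ≤ C / (1 + ‖y‖)) :
    ∀ z, ‖U z‖ ≤ C * (Real.sqrt ν + ν) / (1 + ‖z‖) := by
  intro z
  have ha : 0 < Real.sqrt ν := Real.sqrt_pos.2 hν
  have haa : Real.sqrt ν * Real.sqrt ν = ν := Real.mul_self_sqrt hν.le
  set y : EuclideanSpace ℝ (Fin 3) := (Real.sqrt ν)⁻¹ • rotZ c z with hy
  have hyz : Real.sqrt ν • rotZ (-c) y = z := by
    rw [hy, rotZ_smul, smul_smul, mul_inv_cancel₀ ha.ne', one_smul, ← rotZ_add, neg_add_cancel,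
      rotZ_zero]
  have hny : ‖y‖ = (Real.sqrt ν)⁻¹ * ‖z‖ := by
    rw [hy, norm_smul, norm_inv, Real.norm_of_nonneg ha.le, norm_rotZ]
  have hC : 0 ≤ C := by
    have h0 := (norm_nonneg _).trans (h 0)
    simpa using h0
  have h1 := h y
  rw [hyz, norm_smul, norm_inv, Real.norm_of_nonneg ha.le, norm_rotZ, hny] at h1
  -- `h1 : (√ν)⁻¹ ‖U z‖ ≤ C / (1 + (√ν)⁻¹ ‖z‖)`
  have hden : 0 < 1 + (Real.sqrt ν)⁻¹ * ‖z‖ := by positivity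
  rw [le_div_iff₀ hden] at h1
  rw [le_div_iff₀ (by positivity)]
  -- `‖U z‖ (√ν + ‖z‖) ≤ C ν`
  have h2 : ‖U z‖ * (Real.sqrt ν + ‖z‖) ≤ C * ν := by
    have h3 := mul_le_mul_of_nonneg_left h1 (le_of_lt (mul_pos ha ha))
    have e1 : Real.sqrt ν * Real.sqrt ν * ((Real.sqrt ν)⁻¹ * ‖U z‖ * (1 + (Real.sqrt ν)⁻¹ * ‖z‖)) =
        ‖U z‖ * (Real.sqrt ν + ‖z‖) := by
      field_simp
    rw [e1, haa] at h3
    linarith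
  nlinarith [norm_nonneg (U z), norm_nonneg z, mul_nonneg hC (mul_nonneg ha.le (norm_nonneg z)),
    mul_nonneg hC hν.le, mul_nonneg (norm_nonneg (U z)) ha.le]

/-- **Sub-goal (H) of Stub 2 of line `scaled-energy-split` — RSS witnesses of the finite piece have
Pineau–Vicol-decaying profiles, for every viscosity.**  A classical viscosity-`ν` Navier–Stokes flow on
`(−∞,0)` of rotated self-similar form `v = pvAnsatz α U` with `𝐈(ℝ³ × ℝ₋) < ∞` has
`‖U(y)‖ ≤ C₀/(1 + ‖y‖)` for some `C₀ > 0` (unit viscosity: `stub_finiteRSSProfileDecay`; general `ν`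
by the viscosity normalisation `stub_rssViscosityNormalisation`, `classical_viscosity`,
`typeIBound_viscosity_lt_top`). [cite: Tsai1998, Corollary 4.3 (pp. 46–47); PineauVicol2026, Remark 1.2] -/
theorem stub_rssWitnessDecays : ∀ (ν α : ℝ) (U : EuclideanSpace ℝ (Fin 3) → EuclideanSpace ℝ (Fin 3)) (v : ℝ → EuclideanSpace ℝ (Fin 3) → EuclideanSpace ℝ (Fin 3)) (q : ℝ → EuclideanSpace ℝ (Fin 3) → ℝ), 0 < ν → Literature.Analysis.FluidPDE.IsClassicalNSSolutionOn (Set.Iio 0) ν 0 v q → (∀ t ∈ Set.Iio (0:ℝ), ∀ x, v t x = Literature.Analysis.FluidPDE.pvAnsatz α (fun y _ => U y) t x) → Literature.Analysis.FluidPDE.typeIBound (Set.Iio (0:ℝ) ×ˢ Set.univ) v q (fun t x => fderiv ℝ (v t) x) < ⊤ → ∃ C₀ : ℝ, 0 < C₀ ∧ ∀ y, ‖U y‖ ≤ C₀ / (1 + ‖y‖) := by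
  intro ν α U v q hν hsol hA hI
  have hcl := classical_viscosity hν hsol
  have hIu := typeIBound_viscosity_lt_top hν hI
  rw [visc_velocity_eq, visc_pressure_eq] at hcl hIu
  have hAu := stub_rssViscosityNormalisation ν α U v hν hA
  obtain ⟨C, hC, hdec⟩ := stub_finiteRSSProfileDecay α _ (fun t x => ν⁻¹ • v (ν⁻¹ * t) x)
    (fun t x => (ν⁻¹) ^ 2 * q (ν⁻¹ * t) x) hcl hAu hIu
  refine ⟨C * (Real.sqrt ν + ν), by positivity, ?_⟩
  exact rssWitness_decay_of_normalised hν hdec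

end Summit.NavierStokesRegularity.NavierStokesRegularity.Theorems.FrequencyRigidity.ScaledEnergySplit

end
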